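import Literature.Probability.Percolation.SitePercolationMeasure
import Literature.Probability.Percolation.SiteConnectionTools
import Literature.Probability.Percolation.CerfTwoArms
import Literature.Probability.Percolation.CerfBoxLROProofs
import Literature.Probability.Percolation.CerfCentralInequality
import HarnessLib

/-!
# Cerf 2015, Lemma 6.1 at a parameter with `θ(p) > 0`: proof

Topic `Literature/Probability/Percolation`. Sorry-free discharge of the named fact
`Literature.Probability.Percolation.Cerf2015_lem_6_1_of_siteTheta_pos` (`CerfCentralInequality.lean`): for `d ≥ 2` and
`θ(p) > 0`
there is `c = c(d, p) > 0` with `P_p(x ⟷ y in Λ(2n)) ≥ c / n^{2(d−1)d}` for all `n ≥ 1`,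
`x, y ∈ Λ(n)`. R. Cerf, *A lower bound on the two-arms exponent for critical percolation on the
lattice*, Ann. Probab. 43 (2015) 2458–2480, arXiv:1306.3105, §6 (p. 10 of the 16-page arXiv
rendering), run at a parameter `p` with `θ(p) > 0` as on p. 15.

## The argument (§6, p. 10), as formalised

1. `axis_two_boxes`: by `θ(p) ≤ Σ_{b ∈ ∂ⁱⁿΛ(m)} P(0 ⟷ b in Λ(m))` and `|∂ⁱⁿΛ(m)| ≤ 2d(2m+1)^{d−1}`
   some `b ∈ ∂ⁱⁿΛ(m)` has `P(0 ⟷ b in Λ(m)) ≥ θ/(2d(2m+1)^{d−1})`; a signed coordinate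
   permutation moves `b` to the face `{x_j = s m}` (`s = ±1`), the reflection in that face maps
   `Λ(m)` to `2sm e_j + Λ(m)` fixing the moved point, and Harris–FKG glues the two connections:
   `P(0 ⟷ 2sm e_j in Λ(m) ∪ (2sm e_j + Λ(m))) ≥ (θ/(2d(2m+1)^{d−1}))²`.
2. `chain_even`: for `x, y ∈ Λ(n)` with all `y_i − x_i` even, adjust one coordinate at a time
   (`z_S = ` `y` on `S`, `x` off `S`); each step is a translate of step 1 at scale
   `m = |y_i − x_i|/2 ≤ n` inside `Λ(2n)`, glued by Harris–FKG:
   `P(x ⟷ y in Λ(2n)) ≥ p ρ_n^d`, `ρ_n = min(p, (θ/(2d(2n+1)^{d−1}))²)`.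
3. `Cerf2015_lem_6_1_of_siteTheta_pos_holds`: in general pick `z ∈ Λ(n)` with `z_i − x_i` even and
   `|z_i − y_i| ≤ 1`; `P(z ⟷ y in Λ(2n)) ≥ p^{d+1}` (one-site boosts along a path of length
   `≤ d`), so `P(x ⟷ y in Λ(2n)) ≥ p^{d+2} ρ_n^d ≥ c/n^{2(d−1)d}` with
   `c = p^{d+2} (p θ²/(4d² 9^{d−1}))^d`.

## Main results

* `axis_two_boxes`, `chain_even`;
* `Cerf2015_lem_6_1_of_siteTheta_pos_holds : Cerf2015_lem_6_1_of_siteTheta_pos`.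

## References

* R. Cerf, Ann. Probab. 43 (2015) 2458–2480, arXiv:1306.3105, Lemma 6.1 (p. 10), §10 (p. 15).
* G. Grimmett, *Percolation*, 2nd ed., Springer 1999, Thm 2.4 (Harris–FKG).
-/

noncomputable section

open MeasureTheory Literature.Probability.LatticeModels Literature.Probability.Percolation
open scoped Finset

namespace Literature.Probability.Percolation

section CritPerc

variable {d : ℕ}

/-! ### Step 1: even axis points via reflection -/

/-- Translation invariance for a general finite region: `P_p(w ⟷ v + w in S + w) =
P_p(0 ⟷ v in S)`. [folklore] -/
theorem real_siteConnIn_translate (p : unitInterval) (S : Finset (Site d)) (w v : Site d) :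
    (sitePercolation (Site d) p).real (siteConnIn (zdGraph d) ↑(S.image (· + w)) w (v + w)) =
      (sitePercolation (Site d) p).real (siteConnIn (zdGraph d) ↑S 0 v) := by
  have h := sitePercolation_real_siteConnIn_iso (zdShiftIso w) p (↑S : Set (Site d)) 0 v
  have himg : (zdShiftIso w) '' (↑S : Set (Site d)) = ↑(S.image (· + w)) := by
    rw [Finset.coe_image]; rfl
  rw [himg, zdShiftIso_apply, zdShiftIso_apply, zero_add] at h
  exact h

/-- **Even axis points** (Cerf 2015, proof of Lemma 6.1, p. 10: "`P(0 ⟷ 2ne_1 in Λ(n) ∪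
(2ne_1 + Λ(n))) ≥ … ≥ (1/((2d)(2n+1)^{d−1}))²`", at `p_c`; here at `θ(p) > 0` with `θ(p)` in
the numerator): for every axis `j`, sign `s` and scale `m`,
`(θ/(2d(2m+1)^{d−1}))² ≤ P_p(0 ⟷ 2sm e_j in Λ(m) ∪ (2sm e_j + Λ(m)))`. [cite: Cerf2015, Lem 6.1 (proof)] -/
theorem axis_two_boxes (p : unitInterval) (hθ : 0 < siteTheta (zdGraph d) 0 p) (m : ℕ)
    (j : Fin d) (s : ℤˣ) :
    (siteTheta (zdGraph d) 0 p / (2 * d * (2 * m + 1) ^ (d - 1))) ^ 2 ≤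
      (sitePercolation (Site d) p).real (siteConnIn (zdGraph d)
        ↑(box d m ∪ (box d m).image (· + Pi.single j ((s : ℤ) * (2 * m))))
        0 (Pi.single j ((s : ℤ) * (2 * m)))) := by
  set θ := siteTheta (zdGraph d) 0 p with hθdef
  set μ := sitePercolation (Site d) p with hμ
  obtain ⟨b, hb, hbP⟩ :=
    exists_innerBoundary_siteConnIn_ge (G := zdGraph d) p (box d m) (zero_mem_box d m) hθ
  have hcard_pos : 0 < ((innerBoundary (zdGraph d) (box d m)).card : ℝ) := by
    exact_mod_cast Finset.card_pos.2 ⟨b, hb⟩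
  have hcard_le : ((innerBoundary (zdGraph d) (box d m)).card : ℝ) ≤
      2 * d * (2 * m + 1) ^ (d - 1) := by
    exact_mod_cast card_innerBoundary_box_le (d := d) m
  have hθ0 : 0 ≤ θ := le_of_lt hθ
  have hq0 : 0 ≤ θ / (2 * d * (2 * m + 1) ^ (d - 1)) := div_nonneg hθ0 (by positivity)
  have hq : θ / (2 * d * (2 * m + 1) ^ (d - 1)) ≤
      μ.real (siteConnIn (zdGraph d) ↑(box d m) 0 b) :=
    (div_le_div_of_nonneg_left hθ0 hcard_pos hcard_le).trans hbP
  -- move `b` to the face `{x_j = s m}` by a signed coordinate permutation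
  obtain ⟨i, hi⟩ := exists_eq_of_mem_innerBoundary_box hb
  obtain ⟨t, ht⟩ : ∃ t : ℤˣ, (t : ℤ) * b i = (s : ℤ) * m := by
    rcases hi with h | h
    · exact ⟨s, by rw [h]⟩
    · exact ⟨-s, by rw [h, Units.val_neg]; ring⟩
  set x' : Site d := Site.signedPerm (Equiv.swap i j) (fun _ => t) b with hx'
  have hx'j : x' j = (s : ℤ) * m := by
    rw [hx', Site.signedPerm_apply, Equiv.symm_swap, Equiv.swap_apply_right]; exact ht
  have hsym : μ.real (siteConnIn (zdGraph d) ↑(box d m) 0 x') =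
      μ.real (siteConnIn (zdGraph d) ↑(box d m) 0 b) :=
    real_siteConnIn_signedPerm p m _ _ b
  -- reflect through the face and glue
  have hrefl := real_siteConnIn_reflect p m x' j
  have h2 : 2 * x' j = (s : ℤ) * (2 * m) := by rw [hx'j]; ring
  rw [h2] at hrefl
  set v : Site d := Pi.single j ((s : ℤ) * (2 * m)) with hv
  have hS : box d m ⊆ box d m ∪ (box d m).image (· + v) := Finset.subset_union_left
  have hS' : (box d m).image (· + v) ⊆ box d m ∪ (box d m).image (· + v) :=
    Finset.subset_union_right
  have hglue := real_siteConnIn_mul_le (zdGraph d) p hS hS' 0 x' v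
  rw [hrefl, hsym] at hglue
  calc (θ / (2 * d * (2 * m + 1) ^ (d - 1))) ^ 2
      = (θ / (2 * d * (2 * m + 1) ^ (d - 1))) * (θ / (2 * d * (2 * m + 1) ^ (d - 1))) := sq _
    _ ≤ μ.real (siteConnIn (zdGraph d) ↑(box d m) 0 b) *
          μ.real (siteConnIn (zdGraph d) ↑(box d m) 0 b) :=
        mul_le_mul hq hq hq0 measureReal_nonneg
    _ ≤ _ := hglue

/-! ### Step 2: chaining along the coordinates (even differences) -/

/-- Points with coordinates taken from `x, y ∈ Λ(n)` lie in `Λ(n)`. [folklore] -/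
theorem piecewise_mem_box {n : ℕ} {x y : Site d} (hx : x ∈ box d n) (hy : y ∈ box d n)
    (S : Finset (Fin d)) [DecidablePred (· ∈ S)] : S.piecewise y x ∈ box d n := by
  rw [mem_box] at hx hy ⊢
  intro i
  by_cases hi : i ∈ S
  · rw [Finset.piecewise_eq_of_mem _ _ _ hi]; exact hy i
  · rw [Finset.piecewise_eq_of_notMem _ _ _ hi]; exact hx i

/-- Inserting a coordinate moves the chain point along that axis. [folklore] -/
theorem piecewise_insert_eq (x y : Site d) (S : Finset (Fin d)) [DecidablePred (· ∈ S)]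
    {j : Fin d} [DecidablePred (· ∈ insert j S)] (hj : j ∉ S) :
    (insert j S).piecewise y x = S.piecewise y x + Pi.single j (y j - x j) := by
  funext i
  rcases eq_or_ne i j with rfl | hij
  · rw [Finset.piecewise_eq_of_mem _ _ _ (Finset.mem_insert_self _ _), Pi.add_apply,
      Pi.single_eq_same, Finset.piecewise_eq_of_notMem _ _ _ hj]
    ring
  · rw [Pi.add_apply, Pi.single_eq_of_ne hij, add_zero]
    by_cases hi : i ∈ S
    · rw [Finset.piecewise_eq_of_mem _ _ _ hi,
        Finset.piecewise_eq_of_mem _ _ _ (Finset.mem_insert_of_mem hi)]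
    · rw [Finset.piecewise_eq_of_notMem _ _ _ hi, Finset.piecewise_eq_of_notMem]
      simp [hij, hi]

/-- A translate of `Λ(m)` by a vector of `Λ(n)` lies in `Λ(2n)` when `m ≤ n`. [folklore] -/
theorem image_add_box_subset_two_mul {n m : ℕ} (hmn : m ≤ n) {w : Site d} (hw : w ∈ box d n) :
    (box d m).image (· + w) ⊆ box d (2 * n) :=
  (image_add_box_subset hw).trans (box_mono d (by omega))

/-- **Chaining along the coordinates** (Cerf 2015, proof of Lemma 6.1, p. 10: "We suppose
first that `y_i − x_i` is even … Again by the FKG inequality,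
`P(x ⟷ y in Λ(2n)) ≥ Π_i P(z_i ⟷ z_{i+1} in Λ(2n))` … `(z_i + Λ(n_i)) ∪ (z_{i+1} + Λ(n_i)) ⊆
Λ(2n)`"): for `x, y ∈ Λ(n)` with all coordinate differences even,
`P(x ⟷ y in Λ(2n)) ≥ p · ρ_n^d` with `ρ_n = min(p, (θ/(2d(2n+1)^{d−1}))²)`. [cite: Cerf2015, Lem 6.1 (proof)] -/
theorem chain_even (p : unitInterval) (hθ : 0 < siteTheta (zdGraph d) 0 p) {n : ℕ}
    {x y : Site d} (hx : x ∈ box d n) (hy : y ∈ box d n) (heven : ∀ i, Even (y i - x i)) :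
    (p : ℝ) * (min (p : ℝ) ((siteTheta (zdGraph d) 0 p / (2 * d * (2 * n + 1) ^ (d - 1))) ^ 2)) ^ d ≤
      (sitePercolation (Site d) p).real (siteConnIn (zdGraph d) ↑(box d (2 * n)) x y) := by
  set θ := siteTheta (zdGraph d) 0 p with hθdef
  set μ := sitePercolation (Site d) p with hμ
  set ρ : ℝ := min (p : ℝ) ((θ / (2 * d * (2 * n + 1) ^ (d - 1))) ^ 2) with hρ
  have hp0 : (0 : ℝ) ≤ p := p.2.1
  have hp1 : (p : ℝ) ≤ 1 := p.2.2
  have hρ0 : 0 ≤ ρ := le_min hp0 (sq_nonneg _)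
  have hρ1 : ρ ≤ 1 := (min_le_left _ _).trans hp1
  have hn2 : n ≤ 2 * n := by omega
  -- induction over the set of coordinates already adjusted
  suffices H : ∀ S : Finset (Fin d), (p : ℝ) * ρ ^ S.card ≤
      μ.real (siteConnIn (zdGraph d) ↑(box d (2 * n)) x (S.piecewise y x)) by
    have := H Finset.univ
    rwa [Finset.card_univ, Fintype.card_fin, Finset.piecewise_univ] at this
  intro S
  induction S using Finset.induction_on with
  | empty =>
    rw [Finset.card_empty, pow_zero, mul_one, Finset.piecewise_empty,
      siteConnIn_self_eq (zdGraph d) (Finset.mem_coe.2 (box_mono d hn2 hx)),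
      sitePercolation_real_mem]
  | insert j S hj ih =>
    set w := S.piecewise y x with hw
    have hwB : w ∈ box d n := piecewise_mem_box hx hy S
    have hw'B : (insert j S).piecewise y x ∈ box d n := piecewise_mem_box hx hy _
    have hstep : (insert j S).piecewise y x = w + Pi.single j (y j - x j) :=
      piecewise_insert_eq x y S hj
    rw [Finset.card_insert_of_notMem hj, pow_succ, ← mul_assoc]
    -- write `y j - x j = t (2 m)`
    obtain ⟨k, hk⟩ := heven j
    obtain ⟨t, m, htm⟩ : ∃ (t : ℤˣ) (m : ℕ), k = (t : ℤ) * m := by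
      rcases Int.natAbs_eq k with h | h
      · exact ⟨1, k.natAbs, by simpa using h⟩
      · exact ⟨-1, k.natAbs, by simpa using h⟩
    have hv : y j - x j = (t : ℤ) * (2 * m) := by rw [hk, htm]; ring
    have hmn : m ≤ n := by
      have h1 := (mem_box.1 hx) j
      have h2 := (mem_box.1 hy) j
      have h3 : |y j - x j| ≤ 2 * n := by rw [abs_le]; omega
      rw [hv, abs_mul] at h3
      have h4 : |((t : ℤ))| = 1 := by
        rcases Int.units_eq_one_or t with h | h <;> simp [h]
      rw [h4, one_mul] at h3
      have h5 : |(2 * (m : ℤ))| = 2 * m := abs_of_nonneg (by positivity)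
      rw [h5] at h3
      omega
    rcases Nat.eq_zero_or_pos m with hm0 | hm0
    · -- no move
      have h0 : y j - x j = 0 := by rw [hv, hm0]; simp
      rw [hstep, h0, Pi.single_zero, add_zero]
      calc (p : ℝ) * ρ ^ S.card * ρ ≤ (p : ℝ) * ρ ^ S.card * 1 := by gcongr
        _ = (p : ℝ) * ρ ^ S.card := mul_one _
        _ ≤ _ := ih
    · -- the two-box connection at scale `m`, translated to `w`, inside `Λ(2n)`
      set v : Site d := Pi.single j ((t : ℤ) * (2 * m)) with hvdef
      have hax := axis_two_boxes p hθ m j t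
      rw [← real_siteConnIn_translate p _ w v] at hax
      have hsub : (box d m ∪ (box d m).image (· + v)).image (· + w) ⊆ box d (2 * n) := by
        rw [Finset.image_union]
        apply Finset.union_subset (image_add_box_subset_two_mul hmn hwB)
        rw [Finset.image_image]
        have hcomp : ((· + w) ∘ (· + v) : Site d → Site d) = (· + (w + v)) := by
          funext z; simp only [Function.comp_apply]; abel
        rw [hcomp]
        apply image_add_box_subset_two_mul hmn
        rw [hvdef, ← hv, ← hstep]; exact hw'B
      have hglue := real_siteConnIn_mul_le (zdGraph d) p (subset_refl (box d (2 * n))) hsub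
        x w (v + w)
      have hvw : v + w = (insert j S).piecewise y x := by rw [hstep, hvdef, hv, add_comm]
      rw [hvw] at hglue hax
      -- `ρ ≤ (θ/(2d(2m+1)^{d-1}))²`
      have hρm : ρ ≤ (θ / (2 * d * (2 * m + 1) ^ (d - 1))) ^ 2 := by
        refine (min_le_right _ _).trans ?_
        have hθ0 : 0 ≤ θ := le_of_lt hθ
        have hd0 : 0 < d := Fin.pos j
        have h1 : θ / (2 * d * (2 * n + 1) ^ (d - 1)) ≤ θ / (2 * d * (2 * m + 1) ^ (d - 1)) := by
          apply div_le_div_of_nonneg_left hθ0 (by positivity)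
          have : (2 * (m : ℝ) + 1) ≤ 2 * n + 1 := by
            have : (m : ℝ) ≤ n := by exact_mod_cast hmn
            linarith
          gcongr
        have h0 : 0 ≤ θ / (2 * d * (2 * n + 1) ^ (d - 1)) := div_nonneg hθ0 (by positivity)
        exact pow_le_pow_left₀ h0 h1 2
      calc (p : ℝ) * ρ ^ S.card * ρ
          ≤ μ.real (siteConnIn (zdGraph d) ↑(box d (2 * n)) x w) *
              (θ / (2 * d * (2 * m + 1) ^ (d - 1))) ^ 2 :=
            mul_le_mul ih hρm hρ0 measureReal_nonneg
        _ ≤ μ.real (siteConnIn (zdGraph d) ↑(box d (2 * n)) x w) *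
              μ.real (siteConnIn (zdGraph d)
                ↑((box d m ∪ (box d m).image (· + v)).image (· + w)) w
                  ((insert j S).piecewise y x)) :=
            mul_le_mul_of_nonneg_left hax measureReal_nonneg
        _ ≤ _ := hglue

/-! ### Step 3: the parity correction and the assembly -/

/-- **One-site steps** (Cerf 2015, proof of Lemma 6.1, p. 10: "the probability of connection
between `z` and `y` is larger than `p_c^d`"): if `y, z ∈ Λ(n)` differ by at most one in every
coordinate, `P(z ⟷ y in Λ(2n)) ≥ p^{d+1}`. [cite: Cerf2015, Lem 6.1 (proof)] -/
theorem near_points (p : unitInterval) {n : ℕ} {y z : Site d} (hy : y ∈ box d n)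
    (hz : z ∈ box d n) (hnear : ∀ i, z i = y i ∨ z i = y i + 1 ∨ y i = z i + 1) :
    (p : ℝ) ^ (d + 1) ≤
      (sitePercolation (Site d) p).real (siteConnIn (zdGraph d) ↑(box d (2 * n)) z y) := by
  set μ := sitePercolation (Site d) p with hμ
  have hp0 : (0 : ℝ) ≤ p := p.2.1
  have hp1 : (p : ℝ) ≤ 1 := p.2.2
  have hn2 : n ≤ 2 * n := by omega
  suffices H : ∀ S : Finset (Fin d), (p : ℝ) ^ (S.card + 1) ≤
      μ.real (siteConnIn (zdGraph d) ↑(box d (2 * n)) z (S.piecewise y z)) by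
    have := H Finset.univ
    rwa [Finset.card_univ, Fintype.card_fin, Finset.piecewise_univ] at this
  intro S
  induction S using Finset.induction_on with
  | empty =>
    rw [Finset.card_empty, zero_add, pow_one, Finset.piecewise_empty,
      siteConnIn_self_eq (zdGraph d) (Finset.mem_coe.2 (box_mono d hn2 hz)),
      sitePercolation_real_mem]
  | insert j S hj ih =>
    set w := S.piecewise y z with hw
    have hw'B : (insert j S).piecewise y z ∈ box d (2 * n) :=
      box_mono d hn2 (piecewise_mem_box hz hy _)
    have hstep : (insert j S).piecewise y z = w + Pi.single j (y j - z j) :=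
      piecewise_insert_eq z y S hj
    rw [Finset.card_insert_of_notMem hj]
    have hmono : (p : ℝ) ^ (S.card + 1 + 1) ≤ (p : ℝ) * (p : ℝ) ^ (S.card + 1) := by
      rw [pow_succ, mul_comm]
    refine hmono.trans ?_
    rcases hnear j with h | h | h
    · -- equal coordinates: no move
      have h0 : y j - z j = 0 := by rw [h]; ring
      rw [hstep, h0, Pi.single_zero, add_zero]
      calc (p : ℝ) * (p : ℝ) ^ (S.card + 1) ≤ 1 * (p : ℝ) ^ (S.card + 1) := by gcongr
        _ = (p : ℝ) ^ (S.card + 1) := one_mul _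
        _ ≤ _ := ih
    · -- `w' = w - e_j`
      have hadj : (zdGraph d).Adj w ((insert j S).piecewise y z) := by
        rw [zdGraph_adj_iff]
        refine ⟨j, Or.inr ?_⟩
        rw [hstep, add_assoc, ← Pi.single_add, h]
        simp
      exact (mul_le_mul_of_nonneg_left ih hp0).trans (real_siteConnIn_adj_le _ p hadj hw'B)
    · -- `w' = w + e_j`
      have hadj : (zdGraph d).Adj w ((insert j S).piecewise y z) := by
        rw [zdGraph_adj_iff]
        refine ⟨j, Or.inl ?_⟩
        rw [hstep, h]
        congr 1
        simp
      exact (mul_le_mul_of_nonneg_left ih hp0).trans (real_siteConnIn_adj_le _ p hadj hw'B)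

/-- `min(p, t) ≥ p t` for `p, t ∈ [0, 1]`. [folklore] -/
theorem mul_le_min_of_le_one {a b : ℝ} (ha0 : 0 ≤ a) (ha1 : a ≤ 1) (hb0 : 0 ≤ b) (hb1 : b ≤ 1) :
    a * b ≤ min a b := by
  rcases le_total a b with h | h
  · rw [min_eq_left h]; nlinarith
  · rw [min_eq_right h]; nlinarith

/-- **Cerf 2015, Lemma 6.1 at `θ(p) > 0`, discharged**: for `d ≥ 2` and `θ(p) > 0` there is
`c > 0` (here `c = p^{d+2} (p θ²/(4d² 9^{d−1}))^d`) with `P_p(x ⟷ y in Λ(2n)) ≥ c/n^{2(d−1)d}`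
for all `n ≥ 1`, `x, y ∈ Λ(n)`; see the module docstring. [cite: Cerf2015, Lem 6.1 and §10 p. 15] -/
theorem Cerf2015_lem_6_1_of_siteTheta_pos_holds : Cerf2015_lem_6_1_of_siteTheta_pos := by
  intro d hd p hθ
  set θ := siteTheta (zdGraph d) 0 p with hθdef
  set μ := sitePercolation (Site d) p with hμ
  have hp0 : 0 < (p : ℝ) := pos_of_siteTheta_pos (zdGraph d) 0 p hθ
  have hp1 : (p : ℝ) ≤ 1 := p.2.2
  have hθ1 : θ ≤ 1 := measureReal_le_one
  have hd0 : (0 : ℝ) < d := by exact_mod_cast (show 0 < d by omega)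
  obtain ⟨c₀, hc₀⟩ : ∃ c : ℝ, c = (p : ℝ) * θ ^ 2 / (4 * (d : ℝ) ^ 2 * 9 ^ (d - 1)) := ⟨_, rfl⟩
  have hc₀pos : 0 < c₀ := by rw [hc₀]; positivity
  refine ⟨(p : ℝ) ^ (d + 2) * c₀ ^ d, by positivity, fun n hn x hx y hy => ?_⟩
  have hn0 : (0 : ℝ) < n := by exact_mod_cast (show 0 < n by omega)
  have hn1 : (1 : ℝ) ≤ n := by exact_mod_cast hn
  -- the intermediate point `z`
  set z : Site d := fun i => if Even (y i - x i) then y i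
    else if y i < n then y i + 1 else y i - 1 with hz
  have hzB : z ∈ box d n := by
    rw [mem_box] at hy ⊢
    intro i
    have h := hy i
    simp only [hz]
    split_ifs with h1 h2 <;> omega
  have hzeven : ∀ i, Even (z i - x i) := by
    intro i
    by_cases h1 : Even (y i - x i)
    · have e : z i = y i := by simp [hz, h1]
      rw [e]; exact h1
    · have h1' : Odd (y i - x i) := Int.not_even_iff_odd.mp h1
      by_cases h2 : y i < n
      · have e : z i = y i + 1 := by simp [hz, h1, h2]
        rw [e, show y i + 1 - x i = (y i - x i) + 1 by ring]
        exact h1'.add_one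
      · have e : z i = y i - 1 := by simp [hz, h1, h2]
        rw [e, show y i - 1 - x i = (y i - x i) - 1 by ring]
        exact h1'.sub_odd odd_one
  have hnear : ∀ i, z i = y i ∨ z i = y i + 1 ∨ y i = z i + 1 := by
    intro i
    simp only [hz]
    split_ifs with h1 h2
    · exact Or.inl rfl
    · exact Or.inr (Or.inl rfl)
    · exact Or.inr (Or.inr (by ring))
  -- the two legs
  have hleg1 := chain_even p hθ hx hzB hzeven
  have hleg2 := near_points p hy hzB hnear
  have hglue := real_siteConnIn_mul_le (zdGraph d) p (subset_refl (box d (2 * n)))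
    (subset_refl (box d (2 * n))) x z y
  -- `ρ_n ≥ c₀ / n^{2(d-1)}`
  set ρ : ℝ := min (p : ℝ) ((θ / (2 * d * (2 * n + 1) ^ (d - 1))) ^ 2) with hρ
  have hρ0 : 0 ≤ ρ := le_min hp0.le (sq_nonneg _)
  have ht1 : (θ / (2 * d * (2 * n + 1) ^ (d - 1))) ^ 2 ≤ 1 := by
    have h1 : (1 : ℝ) ≤ 2 * d * (2 * n + 1) ^ (d - 1) := by
      have h2 : (1 : ℝ) ≤ (2 * n + 1) ^ (d - 1) := one_le_pow₀ (by linarith)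
      have h3 : (1 : ℝ) ≤ 2 * d := by
        have : (1 : ℝ) ≤ d := by exact_mod_cast (show 1 ≤ d by omega)
        linarith
      nlinarith
    have h4 : θ / (2 * d * (2 * n + 1) ^ (d - 1)) ≤ 1 := by
      rw [div_le_one (by positivity)]; linarith
    have h5 : 0 ≤ θ / (2 * d * (2 * n + 1) ^ (d - 1)) := div_nonneg hθ.le (by positivity)
    exact pow_le_one₀ h5 h4
  have hρc : c₀ / (n : ℝ) ^ (2 * (d - 1)) ≤ ρ := by
    have h1 : (p : ℝ) * (θ / (2 * d * (2 * n + 1) ^ (d - 1))) ^ 2 ≤ ρ :=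
      mul_le_min_of_le_one hp0.le hp1 (sq_nonneg _) ht1
    refine le_trans ?_ h1
    -- `c₀/n^{2(d-1)} ≤ p (θ/(2d(2n+1)^{d-1}))²` since `2n+1 ≤ 3n`
    have h2 : (2 * (n : ℝ) + 1) ^ (d - 1) ≤ (3 * (n : ℝ)) ^ (d - 1) :=
      pow_le_pow_left₀ (by positivity) (by linarith) _
    have h3 : (p : ℝ) * (θ / (2 * d * (2 * n + 1) ^ (d - 1))) ^ 2 =
        (p : ℝ) * θ ^ 2 / (4 * (d : ℝ) ^ 2 * ((2 * (n : ℝ) + 1) ^ (d - 1)) ^ 2) := by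
      rw [div_pow]; ring
    have h4 : c₀ / (n : ℝ) ^ (2 * (d - 1)) =
        (p : ℝ) * θ ^ 2 / (4 * (d : ℝ) ^ 2 * ((3 * (n : ℝ)) ^ (d - 1)) ^ 2) := by
      have e1 : ((3 * (n : ℝ)) ^ (d - 1)) ^ 2 = 9 ^ (d - 1) * (n : ℝ) ^ (2 * (d - 1)) := by
        rw [← pow_mul, mul_pow, mul_comm (d - 1) 2, pow_mul (3 : ℝ) 2 (d - 1)]
        norm_num
      rw [e1, hc₀]
      field_simp
    rw [h3, h4]
    apply div_le_div_of_nonneg_left (by positivity) (by positivity)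
    gcongr
  -- assemble
  have hmain : (p : ℝ) ^ (d + 2) * c₀ ^ d / (n : ℝ) ^ (2 * (d - 1) * d) ≤
      ((p : ℝ) * ρ ^ d) * (p : ℝ) ^ (d + 1) := by
    have h1 : c₀ ^ d / (n : ℝ) ^ (2 * (d - 1) * d) = (c₀ / (n : ℝ) ^ (2 * (d - 1))) ^ d := by
      rw [div_pow, ← pow_mul]
    have h2 : (c₀ / (n : ℝ) ^ (2 * (d - 1))) ^ d ≤ ρ ^ d :=
      pow_le_pow_left₀ (by positivity) hρc d
    calc (p : ℝ) ^ (d + 2) * c₀ ^ d / (n : ℝ) ^ (2 * (d - 1) * d)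
        = (p : ℝ) ^ (d + 2) * (c₀ / (n : ℝ) ^ (2 * (d - 1))) ^ d := by rw [mul_div_assoc, h1]
      _ ≤ (p : ℝ) ^ (d + 2) * ρ ^ d := by gcongr
      _ = ((p : ℝ) * ρ ^ d) * (p : ℝ) ^ (d + 1) := by ring
  calc (p : ℝ) ^ (d + 2) * c₀ ^ d / (n : ℝ) ^ (2 * (d - 1) * d)
      ≤ ((p : ℝ) * ρ ^ d) * (p : ℝ) ^ (d + 1) := hmain
    _ ≤ μ.real (siteConnIn (zdGraph d) ↑(box d (2 * n)) x z) *
          μ.real (siteConnIn (zdGraph d) ↑(box d (2 * n)) z y) :=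
        mul_le_mul hleg1 hleg2 (by positivity) measureReal_nonneg
    _ ≤ μ.real (siteConnIn (zdGraph d) ↑(box d (2 * n)) x y) := hglue

end CritPerc

end Literature.Probability.Percolation
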